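import Mathlib
import HarnessLib
import Literature.Analysis.FluidPDE.SuitableWeak
import Literature.Analysis.FluidPDE.SelfSimilar
import Literature.Analysis.FluidPDE.LocalTypeI
import Literature.Analysis.FluidPDE.SpaceTimeRescaling
import Literature.Analysis.FluidPDE.LocalTypeIScaling
import Literature.Analysis.FluidPDE.LocalTypeICongr
import Literature.Analysis.FluidPDE.LocalTypeIReverseZoom
import Literature.Analysis.FluidPDE.SlabTypeICompactness
import Literature.Analysis.FluidPDE.TypeIRateOseenMildRepresentative
import Summits.NavierStokesRegularity.NavierStokesRegularity.Theorems.RellichScarApexLocalisationSpherePersistence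
import Summits.NavierStokesRegularity.NavierStokesRegularity.Theorems.RellichScarApexLocalisationClassBlowupPersistence
import Summits.NavierStokesRegularity.NavierStokesRegularity.Theorems.RellichScarApexLocalisationMovingCentrePersistence

/-!
# A blowing-up satellite is a lump (line russian-doll-multiplicity of crux
# `RellichScar.ApexLocalisation`, stub `stub_rdSatelliteLump`)

GRANTED the neighbouring statement S1 ("a backward-singular origin of a suitable weak slab profile
with `𝐈 ≤ I` forces measure `≥ μ` of the lump set `{z ∈ Q_1(0,0) : η/√(−t) < ‖w(z)‖}`", taken here
as a HYPOTHESIS), we prove S2: for every class `(C, I)`, `I < ⊤`, there are `A, η, μ > 0` such that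
every CONTINUOUS rate-`C` suitable weak slab profile `w` with `𝐈 ≤ I` and a point `(t, y)`, `t < 0`,
with `‖w(t, y)‖ ≥ A` has `|{z ∈ Q_1(0, y) : η/√(−s) < ‖w(z)‖}| ≥ μ`.

Proof (contradiction + compactness), with the constants `η, μ` of S1 at `4 I` and `μ/2`:

1. violators `w_k` with `A = k + 1` at points `(t_k, y_k)`: the rate `k + 1 ≤ C/√(−t_k)` forces
   `t_k → 0⁻` (`rdSatelliteLump_tendsto_zero`);
2. `stub_classBlowupPersistence` with unit scales and centres `y_k`: along `σ` the translates
   `w_{σ j}(·, y_{σ j} + ·)` converge in `L³(Q(0, R))` to a continuous class profile `v` (data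
   `(C, 4 I)`) which is backward-singular at the origin; S1 gives `|{z ∈ Q_1(0,0) : η/√(−s) < ‖v‖}| ≥ μ`;
3. transfer (`rdSatelliteLump_measure_le_of_tendsto_ae`, Fatou for an OPEN condition): along an
   a.e.-convergent subsequence, a.e. every point of the lump set of `v` lies in the lump sets of the
   translates from some index on, so continuity of measure from below bounds the measure of the
   lump set of `v` by `μ/2` — the translates' lump sets are translates of the violators' lump sets
   (`rdSatelliteLump_volume_lump_translate`, the space shift preserves Lebesgue measure), of measure
   `< μ/2`. Contradiction.

## References

* D. Albritton, T. Barker, *On local Type I singularities of the Navier–Stokes equations and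
  Liouville theorems*, J. Math. Fluid Mech. 21 (2019) = arXiv:1811.00502, Lemma 2.2, Prop. 2.3,
  §3. [AlbrittonBarker2019]
-/

noncomputable section

set_option linter.dupNamespace false

namespace Summit.NavierStokesRegularity.NavierStokesRegularity.Theorems.RellichScarApexLocalisation

open MeasureTheory Set Function Metric Filter Topology TopologicalSpace
open scoped ENNReal NNReal
open Literature.Analysis Literature.Analysis.FluidPDE
open Summit.NavierStokesRegularity.NavierStokesRegularity.Theorems.ApexLocalisation.Negative

local notation "E³" => EuclideanSpace ℝ (Fin 3)

/-- The open backward slab `(-∞, 0) × ℝ³` (time first). -/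
local notation "𝕊" => Literature.Analysis.FluidPDE.slab (EuclideanSpace ℝ (Fin 3)) (Set.Iio (0 : ℝ)) isOpen_Iio

/-! ### Tools -/

/-- **Times at which rate-`C` fields exceed `k + 1` accumulate at `0⁻`**: if
`k + 1 ≤ ‖w_k(t_k, y_k)‖ ≤ C/√(−t_k)` with `t_k < 0`, then `0 < −t_k ≤ (C/(k+1))² → 0`. -/
theorem rdSatelliteLump_tendsto_zero {C : ℝ} {w : ℕ → ℝ → E³ → E³} {t : ℕ → ℝ} {y : ℕ → E³}
    (hC : ∀ k, HasTypeITimeDecay C (w k)) (ht : ∀ k, t k < 0)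
    (hbig : ∀ k : ℕ, (k : ℝ) + 1 ≤ ‖w k (t k) (y k)‖) : Tendsto t atTop (𝓝 0) := by
  have hbd : ∀ k, -t k ≤ (C / ((k : ℝ) + 1)) ^ 2 := by
    intro k
    have hs : 0 < Real.sqrt (-t k) := Real.sqrt_pos.2 (neg_pos.2 (ht k))
    have hk : (0 : ℝ) < (k : ℝ) + 1 := by positivity
    have h1 : ((k : ℝ) + 1) * Real.sqrt (-t k) ≤ C := by
      have h := (hbig k).trans (hC k (t k) (ht k) (y k))
      rwa [le_div_iff₀ hs] at h
    have h2 : Real.sqrt (-t k) ≤ C / ((k : ℝ) + 1) := by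
      rw [le_div_iff₀' hk]
      exact h1
    calc -t k = Real.sqrt (-t k) ^ 2 := (Real.sq_sqrt (neg_pos.2 (ht k)).le).symm
      _ ≤ (C / ((k : ℝ) + 1)) ^ 2 := pow_le_pow_left₀ (Real.sqrt_nonneg _) h2 2
  have hlim : Tendsto (fun k : ℕ => (C / ((k : ℝ) + 1)) ^ 2) atTop (𝓝 0) := by
    have h1 : Tendsto (fun k : ℕ => C / ((k : ℝ) + 1)) atTop (𝓝 0) :=
      tendsto_const_nhds.div_atTop
        (tendsto_atTop_add_const_right _ _ tendsto_natCast_atTop_atTop)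
    simpa using h1.pow 2
  have hneg : Tendsto (fun k => -t k) atTop (𝓝 0) :=
    squeeze_zero (fun k => (neg_pos.2 (ht k)).le) hbd hlim
  simpa using hneg.neg

/-- **The lump set of a translate is a translate of the lump set**: for the spatial translate
`w(·, a + ·)` the set `{z ∈ Q_1(0,0) : η/√(−s) < ‖w(s, a + x)‖}` has the Lebesgue measure of
`{z ∈ Q_1(0,a) : η/√(−s) < ‖w(z)‖}` (the shift `(s, x) ↦ (s, a + x)` preserves the measure and pulls
the second set back to the first). -/
theorem rdSatelliteLump_volume_lump_translate (η : ℝ) (a : E³) (w : ℝ → E³ → E³) :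
    volume {z ∈ parabolicCylinder 1 (0 : ℝ × E³) |
        η / Real.sqrt (-z.1) < ‖uncurry (Translate.translate a w) z‖} =
      volume {z ∈ parabolicCylinder 1 ((0 : ℝ), a) | η / Real.sqrt (-z.1) < ‖w z.1 z.2‖} := by
  have e : {z ∈ parabolicCylinder 1 (0 : ℝ × E³) |
        η / Real.sqrt (-z.1) < ‖uncurry (Translate.translate a w) z‖} =
      (fun z : ℝ × E³ => (z.1, a + z.2)) ⁻¹'
        {z ∈ parabolicCylinder 1 ((0 : ℝ), a) | η / Real.sqrt (-z.1) < ‖w z.1 z.2‖} := by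
    ext z
    simp [mem_parabolicCylinder, dist_eq_norm, uncurry_translate]
  rw [e, (measurePreserving_spaceShift a).measure_preimage_emb (measurableEmbedding_spaceShift a)]

/-- **Open conditions pass from an a.e. limit back to the sequence, in measure** (Fatou for
indicators of superlevel sets, via continuity of measure from below): if `f i → g` a.e. on a
measurable set `Q` and every set `{z ∈ Q | c z < ‖f i z‖}` has measure `≤ b`, then
`{z ∈ Q | c z < ‖g z‖}` has measure `≤ b` — off a null set it lies in the increasing union over `n`
of `{z ∈ Q | ∀ i ≥ n, c z < ‖f i z‖} ⊆ {z ∈ Q | c z < ‖f n z‖}`. -/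
theorem rdSatelliteLump_measure_le_of_tendsto_ae {α F : Type*} [MeasurableSpace α]
    [NormedAddCommGroup F] {μ : Measure α} {Q : Set α} (hQ : MeasurableSet Q)
    {f : ℕ → α → F} {g : α → F} {c : α → ℝ} {b : ℝ≥0∞}
    (hae : ∀ᵐ z ∂(μ.restrict Q), Tendsto (fun i => f i z) atTop (𝓝 (g z)))
    (hb : ∀ i, μ {z ∈ Q | c z < ‖f i z‖} ≤ b) :
    μ {z ∈ Q | c z < ‖g z‖} ≤ b := by
  rw [ae_restrict_iff' hQ, ae_iff] at hae
  -- the increasing sets `S n = {z ∈ Q | ∀ i ≥ n, c z < ‖f i z‖} ⊆ {z ∈ Q | c z < ‖f n z‖}`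
  have hSmono : Monotone fun n : ℕ => {z ∈ Q | ∀ i, n ≤ i → c z < ‖f i z‖} := by
    intro m n hmn z hz
    exact ⟨hz.1, fun i hi => hz.2 i (hmn.trans hi)⟩
  have hSle : ∀ n : ℕ, μ {z ∈ Q | ∀ i, n ≤ i → c z < ‖f i z‖} ≤ b := by
    intro n
    refine (measure_mono ?_).trans (hb n)
    intro z hz
    exact ⟨hz.1, hz.2 n le_rfl⟩
  -- off the null set of non-convergence, the superlevel set of the limit lies in their union
  have hsub : {z ∈ Q | c z < ‖g z‖} ⊆
      {z | ¬ (z ∈ Q → Tendsto (fun i => f i z) atTop (𝓝 (g z)))} ∪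
        ⋃ n : ℕ, {z ∈ Q | ∀ i, n ≤ i → c z < ‖f i z‖} := by
    rintro z ⟨hzQ, hz⟩
    by_cases ht : Tendsto (fun i => f i z) atTop (𝓝 (g z))
    · obtain ⟨n, hn⟩ := eventually_atTop.1 (ht.norm.eventually_const_lt hz)
      exact Or.inr (mem_iUnion.2 ⟨n, hzQ, hn⟩)
    · exact Or.inl fun h => ht (h hzQ)
  calc μ {z ∈ Q | c z < ‖g z‖}
      ≤ μ ({z | ¬ (z ∈ Q → Tendsto (fun i => f i z) atTop (𝓝 (g z)))} ∪
          ⋃ n : ℕ, {z ∈ Q | ∀ i, n ≤ i → c z < ‖f i z‖}) := measure_mono hsub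
    _ ≤ μ {z | ¬ (z ∈ Q → Tendsto (fun i => f i z) atTop (𝓝 (g z)))} +
          μ (⋃ n : ℕ, {z ∈ Q | ∀ i, n ≤ i → c z < ‖f i z‖}) := measure_union_le _ _
    _ = ⨆ n : ℕ, μ {z ∈ Q | ∀ i, n ≤ i → c z < ‖f i z‖} := by
        rw [hae, zero_add, hSmono.measure_iUnion]
    _ ≤ b := iSup_le hSle

/-! ### The stub -/

/-- **S2 (stub_rdSatelliteLump).** Granted S1: for every class `(C, I)`, `I < ⊤`, there are
`A, η, μ > 0` such that every continuous rate-`C` suitable weak slab profile with `𝐈 ≤ I` and a point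
`(t, y)`, `t < 0`, with `‖w(t,y)‖ ≥ A` has `|{z ∈ Q_1(0,y) : η/√(−s) < ‖w(z)‖}| ≥ μ` (contradiction:
violators with `A = k + 1` have `t_k → 0⁻` by the rate; `stub_classBlowupPersistence` with unit scales
and centres `y_k` gives an origin-singular limit of the translates; S1 for the limit; Fatou transfers the
measure bound back to the translates). [cite: AlbrittonBarker2019, Lemma 2.2, Prop. 2.3 and §3] -/
theorem stub_rdSatelliteLump :
    (∀ (I : ℝ≥0∞), I < ⊤ → ∃ η : ℝ, 0 < η ∧ ∃ μ : ℝ, 0 < μ ∧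
      ∀ (w : ℝ → E³ → E³) (q : ℝ → E³ → ℝ) (H : ℝ → E³ → E³ →L[ℝ] E³),
        IsSuitableWeakSolutionOn 𝕊 1 0 w q → HasWeakSpatialGradientOn 𝕊 w H →
        typeIBound (Iio (0 : ℝ) ×ˢ univ) w q H ≤ I → IsBackwardSingularPoint w 0 →
        ENNReal.ofReal μ ≤
          volume {z ∈ parabolicCylinder 1 (0 : ℝ × E³) | η / Real.sqrt (-z.1) < ‖w z.1 z.2‖}) →
    ∀ (C : ℝ) (I : ℝ≥0∞), I < ⊤ → ∃ A : ℝ, 0 < A ∧ ∃ η : ℝ, 0 < η ∧ ∃ μ : ℝ, 0 < μ ∧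
      ∀ (w : ℝ → E³ → E³) (q : ℝ → E³ → ℝ) (H : ℝ → E³ → E³ →L[ℝ] E³),
        IsSuitableWeakSolutionOn 𝕊 1 0 w q → HasWeakSpatialGradientOn 𝕊 w H →
        typeIBound (Iio (0 : ℝ) ×ˢ univ) w q H ≤ I → HasTypeITimeDecay C w →
        ContinuousOn (uncurry w) (Iio (0 : ℝ) ×ˢ univ) →
        ∀ (t : ℝ) (y : E³), t < 0 → A ≤ ‖w t y‖ →
        ENNReal.ofReal μ ≤
          volume {z ∈ parabolicCylinder 1 ((0 : ℝ), y) | η / Real.sqrt (-z.1) < ‖w z.1 z.2‖} := by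
  intro hS1 C I hI
  -- ## the constants: those of S1 at `4 I`, and `μ / 2`
  obtain ⟨η, hη, μ, hμ, hlump⟩ := hS1 (4 * I) (ENNReal.mul_lt_top (by simp) hI)
  by_contra hcon
  push Not at hcon
  -- ## Step 1: violators with `A = k + 1`
  choose w q H hsw hwg hIle hC hcont t y ht hbig hsmall using
    fun k : ℕ => hcon ((k : ℝ) + 1) (by positivity) η hη (μ / 2) (half_pos hμ)
  -- ## Step 2: `t_k → 0⁻` and blow-up at `(t_k, y_k)`
  have ht0 : Tendsto t atTop (𝓝 0) := rdSatelliteLump_tendsto_zero hC ht hbig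
  have hblow : Tendsto (fun k => ‖w k (t k) (y k)‖) atTop atTop :=
    tendsto_atTop_mono hbig (tendsto_atTop_add_const_right _ _ tendsto_natCast_atTop_atTop)
  -- ## Step 3: class blow-up persistence with unit scales and centres `y_k`
  obtain ⟨σ, v, q', H', -, hswv, hwgv, hIv, -, hcontv, hsingv, hconv⟩ :=
    stub_classBlowupPersistence C I w q H (fun _ => 1) y t hI hsw hwg hIle hC hcont
      (fun _ => one_pos) ht ht0 (by simpa only [one_mul, one_pow] using hblow)
  -- ## Step 4: S1 for the limit
  have hT : ENNReal.ofReal μ ≤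
      volume {z ∈ parabolicCylinder 1 (0 : ℝ × E³) | η / Real.sqrt (-z.1) < ‖v z.1 z.2‖} :=
    hlump v q' H' hswv hwgv hIv hsingv
  -- ## Step 5: an a.e.-convergent subsequence of the translates on `Q_1(0,0)`
  have hQm : MeasurableSet (parabolicCylinder 1 (0 : ℝ × E³)) :=
    (isOpen_parabolicCylinder _ _).measurableSet
  have hQs : parabolicCylinder 1 (0 : ℝ × E³) ⊆ Iio (0 : ℝ) ×ˢ (univ : Set E³) :=
    parabolicCylinder_origin_subset_slab 1
  have hL3 : Tendsto (fun j =>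
      eLpNorm (uncurry (Translate.translate (y (σ j)) (w (σ j))) - uncurry v) 3
        (volume.restrict (parabolicCylinder 1 (0 : ℝ × E³)))) atTop (𝓝 0) := by
    refine (hconv 1 one_pos).congr fun j => ?_
    rw [Translate.translate_u_eq]
  have hWm : ∀ j, AEStronglyMeasurable (uncurry (Translate.translate (y (σ j)) (w (σ j))))
      (volume.restrict (parabolicCylinder 1 (0 : ℝ × E³))) := fun j =>
    (continuousOn_translate_parabolicCylinder (hcont (σ j)) (y (σ j)) 1).aestronglyMeasurable hQm
  have hvm : AEStronglyMeasurable (uncurry v) (volume.restrict (parabolicCylinder 1 (0 : ℝ × E³))) :=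
    (hcontv.mono hQs).aestronglyMeasurable hQm
  have hTIM : TendstoInMeasure (volume.restrict (parabolicCylinder 1 (0 : ℝ × E³)))
      (fun j => uncurry (Translate.translate (y (σ j)) (w (σ j)))) atTop (uncurry v) :=
    tendstoInMeasure_of_tendsto_eLpNorm (by norm_num) hWm hvm hL3
  obtain ⟨ns, -, hae⟩ := hTIM.exists_seq_tendsto_ae
  -- ## Step 6: the lump sets of the translates are small (translation), hence so is the limit's
  have hb : ∀ i, volume {z ∈ parabolicCylinder 1 (0 : ℝ × E³) | η / Real.sqrt (-z.1) <
      ‖uncurry (Translate.translate (y (σ (ns i))) (w (σ (ns i)))) z‖} ≤ ENNReal.ofReal (μ / 2) := by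
    intro i
    rw [rdSatelliteLump_volume_lump_translate]
    exact (hsmall _).le
  have hle : volume {z ∈ parabolicCylinder 1 (0 : ℝ × E³) | η / Real.sqrt (-z.1) < ‖v z.1 z.2‖} ≤
      ENNReal.ofReal (μ / 2) :=
    rdSatelliteLump_measure_le_of_tendsto_ae hQm (c := fun z : ℝ × E³ => η / Real.sqrt (-z.1))
      hae hb
  -- ## Conclusion: `μ ≤ μ / 2`
  have hμle := hT.trans hle
  rw [ENNReal.ofReal_le_ofReal_iff (half_pos hμ).le] at hμle
  linarith

end Summit.NavierStokesRegularity.NavierStokesRegularity.Theorems.RellichScarApexLocalisation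

end
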